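import Mathlib
import HarnessLib
import HarnessLib.Audit
import Summits.ValiantsHypothesis.ValiantsHypothesis.Theorems.SoloBlindTwoSum

/-!
# Refutation of the sharp two-sum vertex bound

`TwoSumVertexBound` (`SoloBlindTwoSum`): "if `0 ∈ I ⊆ ℤ²` is finite and every point of `I` is strictly separated from
the outer pair sums `W(I) = ((I∖0)+(I∖0)) ∖ I`, then `conv W(I) + cone(I∖0)` has at most `#I` strict vertices."
It is **false**: the eight-point instance `cxD = {0, a, a', x, 2a, c, 2a', d}` with `a = (5,10)`, `a' = (8,4)`,
`x = (8,9)`, `c = (14,30)`, `d = (48,20)` (defined in `SoloBlindCoreRefutation`) is valid and has the nine strict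
vertices `cxV = {2d, d+a', 3a', a'+x, a+a', a+x, 3a, a+c, 2c}`.  Everything is a finite check (`decide`) once the 26
outer sums are computed (`outerSums_cxD`).  Mechanism: the doubled elements `a, a'` are adjacent on the hull of
`I`, each spawns the extra vertex `3a`, `3a'`, and the pocket point `x` is summed with both.
-/

namespace Summit.ValiantsHypothesis.ValiantsHypothesis.Theorems

/-! ### The counterexample to the sharp form -/

/-- The outer sums of the counterexample instance `cxD`, computed (26 points). -/
theorem outerSums_cxD : outerSums cxD =
      {(13, 14), (13, 19), (15, 30), (16, 13), (16, 18), (18, 24), (18, 29), (19, 40), (20, 40),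
       (21, 18), (22, 34), (22, 39), (24, 12), (24, 17), (24, 50), (26, 28), (28, 60), (30, 38),
       (32, 16), (53, 30), (56, 24), (56, 29), (58, 40), (62, 50), (64, 28), (96, 40)} := by
  decide

/-- The counterexample instance is valid: every point of `cxD` is separated from its outer sums. -/
theorem cxD_separated : ∀ y ∈ cxD, Separated cxD y := by
  intro y hy
  unfold Separated
  rw [outerSums_cxD]
  simp only [cxD, Finset.mem_insert, Finset.mem_singleton] at hy
  rcases hy with rfl | rfl | rfl | rfl | rfl | rfl | rfl | rfl
  · exact ⟨1, 0, by decide, by decide⟩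
  · exact ⟨1, 0, by decide, by decide⟩
  · exact ⟨1, 0, by decide, by decide⟩
  · exact ⟨1, 0, by decide, by decide⟩
  · exact ⟨1, 0, by decide, by decide⟩
  · exact ⟨11, -2, by decide, by decide⟩
  · exact ⟨1, 3, by decide, by decide⟩
  · exact ⟨-3, 8, by decide, by decide⟩

/-- The nine points of `cxV` are strict vertices of the counterexample instance. -/
theorem cxV_strictVertex : ∀ v ∈ cxV, IsStrictVertex cxD v := by
  intro v hv
  unfold IsStrictVertex
  rw [outerSums_cxD]
  simp only [cxV, Finset.mem_insert, Finset.mem_singleton] at hv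
  rcases hv with rfl | rfl | rfl | rfl | rfl | rfl | rfl | rfl | rfl
  · exact ⟨by decide, -9, 22, by decide, by decide⟩
  · exact ⟨by decide, -7, 18, by decide, by decide⟩
  · exact ⟨by decide, -3, 16, by decide, by decide⟩
  · exact ⟨by decide, 2, 11, by decide, by decide⟩
  · exact ⟨by decide, 2, 1, by decide, by decide⟩
  · exact ⟨by decide, 8, -1, by decide, by decide⟩
  · exact ⟨by decide, 7, -2, by decide, by decide⟩
  · exact ⟨by decide, 30, -13, by decide, by decide⟩
  · exact ⟨by decide, 50, -23, by decide, by decide⟩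

/-- **The sharp two-sum vertex bound is false**: `cxD` (eight points) is valid and has nine strict vertices. -/
theorem not_twoSumVertexBound : ¬ TwoSumVertexBound := by
  intro h
  have h98 := h cxD cxV (by decide) cxD_separated cxV_strictVertex
  have h9 : cxV.card = 9 := by decide
  have h8 : cxD.card = 8 := by decide
  omega

/-- The counterexample in numbers. -/
theorem twoSum_counterexample :
    ∃ I V : Finset (ℤ × ℤ), (0 : ℤ × ℤ) ∈ I ∧ (∀ y ∈ I, Separated I y) ∧
      (∀ v ∈ V, IsStrictVertex I v) ∧ V.card = I.card + 1 :=
  ⟨cxD, cxV, by decide, cxD_separated, cxV_strictVertex, by decide⟩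

/-! ### A valid instance with two extra vertices

The additive excess `#V − #I` is not bounded either: chaining three doubled elements gives `#V = #I + 2`
(found by the same structured search; eleven points, thirteen strict vertices).  Along such chains the line-model
analysis predicts `#V = #I + μ − 1` for `μ` doubled elements, ratio `→ 4/3`. -/

/-- The eleven-point instance with thirteen strict vertices. -/
def cxD3 : Finset (ℤ × ℤ) :=
  {(0, 0), (4, 2), (5, 7), (8, 4), (8, 15), (11, 4), (16, 30), (18, 34), (19, 6), (38, 12),
   (94, 29)}

/-- Its thirteen strict vertices. -/
def cxV3 : Finset (ℤ × ℤ) :=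
  {(9, 9), (10, 14), (12, 6), (13, 22), (15, 6), (23, 8), (24, 45), (26, 49), (30, 10), (36, 68),
   (57, 18), (113, 35), (188, 58)}

set_option maxRecDepth 10000 in
/-- The outer sums of `cxD3`, computed (52 points). -/
theorem outerSums_cxD3 : outerSums cxD3 =
      {(9, 9), (10, 14), (12, 6), (12, 17), (13, 11), (13, 22), (15, 6), (16, 8), (16, 11),
       (16, 19), (19, 8), (19, 19), (20, 32), (21, 37), (22, 8), (22, 36), (23, 8), (23, 41),
       (24, 13), (24, 34), (24, 45), (26, 38), (26, 49), (27, 10), (27, 21), (27, 34), (29, 38),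
       (30, 10), (32, 60), (34, 64), (35, 36), (36, 68), (37, 40), (42, 14), (43, 19), (46, 16),
       (46, 27), (49, 16), (54, 42), (56, 46), (57, 18), (76, 24), (98, 31), (99, 36), (102, 33),
       (102, 44), (105, 33), (110, 59), (112, 63), (113, 35), (132, 41), (188, 58)} := by
  decide +kernel

set_option maxRecDepth 10000 in
/-- `cxD3` is valid. -/
theorem cxD3_separated : ∀ y ∈ cxD3, Separated cxD3 y := by
  intro y hy
  unfold Separated
  rw [outerSums_cxD3]
  simp only [cxD3, Finset.mem_insert, Finset.mem_singleton] at hy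
  rcases hy with rfl | rfl | rfl | rfl | rfl | rfl | rfl | rfl | rfl | rfl | rfl
  · exact ⟨5, -1, by decide +kernel, by decide +kernel⟩
  · exact ⟨5, -1, by decide +kernel, by decide +kernel⟩
  · exact ⟨5, -1, by decide +kernel, by decide +kernel⟩
  · exact ⟨1, 1, by decide +kernel, by decide +kernel⟩
  · exact ⟨5, -1, by decide +kernel, by decide +kernel⟩
  · exact ⟨1, 1, by decide +kernel, by decide +kernel⟩
  · exact ⟨23, -11, by decide +kernel, by decide +kernel⟩
  · exact ⟨23, -11, by decide +kernel, by decide +kernel⟩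
  · exact ⟨-1, 4, by decide +kernel, by decide +kernel⟩
  · exact ⟨-2, 7, by decide +kernel, by decide +kernel⟩
  · exact ⟨-17, 56, by decide +kernel, by decide +kernel⟩

set_option maxRecDepth 10000 in
/-- The thirteen points of `cxV3` are strict vertices of `cxD3`. -/
theorem cxV3_strictVertex : ∀ v ∈ cxV3, IsStrictVertex cxD3 v := by
  intro v hv
  unfold IsStrictVertex
  rw [outerSums_cxD3]
  simp only [cxV3, Finset.mem_insert, Finset.mem_singleton] at hv
  rcases hv with rfl | rfl | rfl | rfl | rfl | rfl | rfl | rfl | rfl | rfl | rfl | rfl | rfl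
  · exact ⟨by decide +kernel, 4, 1, by decide +kernel, by decide +kernel⟩
  · exact ⟨by decide +kernel, 13, -4, by decide +kernel, by decide +kernel⟩
  · exact ⟨by decide +kernel, 1, 2, by decide +kernel, by decide +kernel⟩
  · exact ⟨by decide +kernel, 31, -14, by decide +kernel, by decide +kernel⟩
  · exact ⟨by decide +kernel, -2, 11, by decide +kernel, by decide +kernel⟩
  · exact ⟨by decide +kernel, -4, 15, by decide +kernel, by decide +kernel⟩
  · exact ⟨by decide +kernel, 27, -13, by decide +kernel, by decide +kernel⟩
  · exact ⟨by decide +kernel, 23, -12, by decide +kernel, by decide +kernel⟩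
  · exact ⟨by decide +kernel, -5, 17, by decide +kernel, by decide +kernel⟩
  · exact ⟨by decide +kernel, 53, -28, by decide +kernel, by decide +kernel⟩
  · exact ⟨by decide +kernel, -25, 83, by decide +kernel, by decide +kernel⟩
  · exact ⟨by decide +kernel, -40, 131, by decide +kernel, by decide +kernel⟩
  · exact ⟨by decide +kernel, -4, 13, by decide +kernel, by decide +kernel⟩

set_option maxRecDepth 10000 in
/-- A valid instance with `#V = #I + 2`. -/
theorem twoSum_gap_two :
    ∃ I V : Finset (ℤ × ℤ), (0 : ℤ × ℤ) ∈ I ∧ (∀ y ∈ I, Separated I y) ∧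
      (∀ v ∈ V, IsStrictVertex I v) ∧ V.card = I.card + 2 :=
  ⟨cxD3, cxV3, by decide +kernel, cxD3_separated, cxV3_strictVertex, by decide +kernel⟩

end Summit.ValiantsHypothesis.ValiantsHypothesis.Theorems
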